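import Summits.Parity.BatemanHorn.Theorems.SoloInformedRootCountSquarefull
import Summits.Parity.BatemanHorn.Theorems.SoloInformedRootCountSquarefreeLevel
import HarnessLib

/-!
# The Dedekind–Landau mean value `∑_{d ≤ x} ρ_g(d)/d = A_g log x + O(1)` in the kernel

Solo informed line (Parity / Bateman–Horn), session 136.  For `g ∈ ℤ[X]` irreducible of positive
degree, the small level `polySmallLevel g x = ∑_{d ≤ x} ρ_g(d)/d` of
`SoloInformedDivisorPairingStorey` satisfies

  `|polySmallLevel g x − A_g log x| ≤ K_g`   for all `x ≥ 1`

(`exists_abs_polySmallLevel_sub_log_le`), with the constant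
`A_g = rootLevelConst g = ∑_{k squarefull} ρ_g(k) c_{g,k}/k` (`c_{g,k} = rootDensityConst g k`, the
GGPY constant of the weight `γ_{g,k}`).  Classically `A_g` is the residue of the Dedekind zeta
function of `ℚ[X]/(g)` up to finitely many Euler factors; here it is produced by elementary means:

* the squarefree · squarefull decomposition
  `polySmallLevel g x = ∑_{k ≤ x squarefull} (ρ_g(k)/k) polySqfreeLevel g k ⌊x/k⌋`
  (`SoloInformedRootCountSquarefull.polySmallLevel_eq_sum_sqfull`);
* the squarefree level `|polySqfreeLevel g k y − c_{g,k} log y| ≤ K (1 + log k)`, `0 ≤ c_{g,k} ≤ c_{g,1}`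
  (`SoloInformedRootCountSquarefreeLevel.exists_abs_polySqfreeLevel_sub_le`: GGPY Lemma 3 with
  `κ = 1` + Landau–Mertens for `ρ_g`, both PROVED in the tree);
* the uniform squarefull weight bound `∑_{k ≤ Z squarefull} ρ_g(k)(1 + log k)/k ≤ W`
  (`exists_sum_sqfull_rootCount_weight_le`), which makes `A_g` an absolutely convergent series and
  controls the tail `(A_g − ∑_{k ≤ x}) log x ≤ ∑_{k > x} ρ_g(k) c_{g,k} log k/k ≤ c_{g,1} W`.

Consequence (`exists_abs_polyDivisorSum_sub_located_sub_log_le_uncond`): hypothesis `hL` of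
`SoloInformedDivisorPairingStorey.exists_abs_polyDivisorSum_sub_located_sub_log_le` is discharged, so
for every irreducible `g` of positive degree with `n² ≤ |g(n)|` (`n ≥ 1`),
`∑_{n ≤ x} τ(g(n)) = 2 A_g x log x + 2 N_g(x) + O_g(x)` UNCONDITIONALLY, where
`N_g(x) = polyLocatedRootCount g x` counts the located roots `d ∣ g(n)`, `x < d`, `d² < |g(n)|`; in
particular for `X³ + 2` (`exists_abs_polyDivisorSum_cubic_sub_log_le`).  The whole difficulty of the
asymptotic for `∑ τ(n³+2)` is thereby isolated, in the kernel, in the single count `N_g(x)`.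
-/

noncomputable section

open Finset Real Polynomial Filter Topology

namespace Summit.Parity.BatemanHorn.Theorems

open Literature.NumberTheory.Sieve

/-! ### The constant `A_g` -/

/-- `a_k = ρ_g(k) c_{g,k}/k` for squarefull `k`, `0` otherwise (and `a_0 = 0`). [this work] -/
def rootLevelCoeff (g : ℤ[X]) (k : ℕ) : ℝ :=
  if (∀ p ∈ k.primeFactors, p ^ 2 ∣ k) then
    (polyRootCountMod ![g] k : ℝ) * rootDensityConst g k / k
  else 0

/-- The Dedekind–Landau constant `A_g = ∑_{k squarefull} ρ_g(k) c_{g,k}/k`. [this work] -/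
def rootLevelConst (g : ℤ[X]) : ℝ := ∑' k, rootLevelCoeff g k

/-- A range sum of `1_P · φ` with `φ(0) = 0` is the filtered sum over `[1, x]`. [folklore] -/
theorem sum_range_succ_ite_eq_sum_filter (P : ℕ → Prop) [DecidablePred P] (φ : ℕ → ℝ)
    (hφ : φ 0 = 0) (x : ℕ) :
    ∑ k ∈ range (x + 1), (if P k then φ k else 0) = ∑ k ∈ (Icc 1 x).filter P, φ k := by
  rw [Finset.range_eq_Ico, Finset.sum_eq_sum_Ico_succ_bot (by omega : (0 : ℕ) < x + 1)]
  have h0 : (if P 0 then φ 0 else 0) = 0 := by rw [hφ, ite_self]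
  rw [h0]
  simp only [zero_add]
  rw [Finset.Ico_add_one_right_eq_Icc, Finset.sum_filter]

/-- `∑_{k < x+1} a_k = ∑_{k ≤ x squarefull} ρ_g(k) c_{g,k}/k`. [this work] -/
theorem sum_range_rootLevelCoeff (g : ℤ[X]) (x : ℕ) :
    ∑ k ∈ range (x + 1), rootLevelCoeff g k =
      ∑ k ∈ (Icc 1 x).filter (fun k : ℕ => ∀ p ∈ k.primeFactors, p ^ 2 ∣ k),
        (polyRootCountMod ![g] k : ℝ) * rootDensityConst g k / k := by
  unfold rootLevelCoeff
  exact sum_range_succ_ite_eq_sum_filter _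
    (fun k => (polyRootCountMod ![g] k : ℝ) * rootDensityConst g k / k) (by simp) x

/-- `a_k ≥ 0` (given `c_{g,m} ≥ 0` for `m ≥ 1`). [this work] -/
theorem rootLevelCoeff_nonneg (g : ℤ[X]) (hc0 : ∀ m : ℕ, 0 < m → 0 ≤ rootDensityConst g m)
    (k : ℕ) : 0 ≤ rootLevelCoeff g k := by
  unfold rootLevelCoeff
  split_ifs
  · rcases Nat.eq_zero_or_pos k with rfl | hk
    · simp
    · exact div_nonneg (mul_nonneg (Nat.cast_nonneg _) (hc0 k hk)) (Nat.cast_nonneg _)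
  · exact le_rfl

/-- A weight sum over `[1, 0]` is empty, so the uniform bound `W` is `≥ 0`. [folklore] -/
theorem weightBound_nonneg {g : ℤ[X]} {W : ℝ}
    (hW : ∀ Z : ℕ, ∑ k ∈ (Icc 1 Z).filter (fun k : ℕ => ∀ p ∈ k.primeFactors, p ^ 2 ∣ k),
        (polyRootCountMod ![g] k : ℝ) * (1 + Real.log k) / k ≤ W) : 0 ≤ W := by
  have h := hW 0
  rwa [Finset.Icc_eq_empty_of_lt Nat.zero_lt_one, Finset.filter_empty, Finset.sum_empty] at h

/-- The partial sums of `a_k` are bounded: `∑_{k < Z} a_k ≤ c_{g,1} W`. [this work] -/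
theorem sum_range_rootLevelCoeff_le (g : ℤ[X]) {c₁ W : ℝ} (hc₁ : 0 ≤ c₁)
    (hc1 : ∀ m : ℕ, 0 < m → rootDensityConst g m ≤ c₁)
    (hW : ∀ Z : ℕ, ∑ k ∈ (Icc 1 Z).filter (fun k : ℕ => ∀ p ∈ k.primeFactors, p ^ 2 ∣ k),
        (polyRootCountMod ![g] k : ℝ) * (1 + Real.log k) / k ≤ W)
    (Z : ℕ) : ∑ k ∈ range Z, rootLevelCoeff g k ≤ c₁ * W := by
  have hW0 : 0 ≤ W := weightBound_nonneg hW
  rcases Nat.eq_zero_or_pos Z with rfl | hZ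
  · rw [Finset.sum_range_zero]
    exact mul_nonneg hc₁ hW0
  · obtain ⟨x, rfl⟩ : ∃ x, Z = x + 1 := ⟨Z - 1, by omega⟩
    rw [sum_range_rootLevelCoeff]
    calc ∑ k ∈ (Icc 1 x).filter (fun k : ℕ => ∀ p ∈ k.primeFactors, p ^ 2 ∣ k),
          (polyRootCountMod ![g] k : ℝ) * rootDensityConst g k / k
        ≤ ∑ k ∈ (Icc 1 x).filter (fun k : ℕ => ∀ p ∈ k.primeFactors, p ^ 2 ∣ k),
            c₁ * ((polyRootCountMod ![g] k : ℝ) * (1 + Real.log k) / k) := by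
          refine Finset.sum_le_sum fun k hk => ?_
          have hk1 : 1 ≤ k := (Finset.mem_Icc.1 (Finset.mem_filter.1 hk).1).1
          have hk1' : (1 : ℝ) ≤ k := by exact_mod_cast hk1
          have hk0 : (0 : ℝ) < k := by linarith
          have hlog : 1 ≤ 1 + Real.log k := by
            have := Real.log_nonneg hk1'
            linarith
          have hρ0 : 0 ≤ (polyRootCountMod ![g] k : ℝ) := Nat.cast_nonneg _
          have h1 : (polyRootCountMod ![g] k : ℝ) * rootDensityConst g k ≤
              c₁ * ((polyRootCountMod ![g] k : ℝ) * (1 + Real.log k)) := by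
            calc (polyRootCountMod ![g] k : ℝ) * rootDensityConst g k
                ≤ (polyRootCountMod ![g] k : ℝ) * c₁ := mul_le_mul_of_nonneg_left (hc1 k hk1) hρ0
              _ = c₁ * ((polyRootCountMod ![g] k : ℝ) * 1) := by ring
              _ ≤ c₁ * ((polyRootCountMod ![g] k : ℝ) * (1 + Real.log k)) :=
                  mul_le_mul_of_nonneg_left (mul_le_mul_of_nonneg_left hlog hρ0) hc₁
          calc (polyRootCountMod ![g] k : ℝ) * rootDensityConst g k / k
              ≤ c₁ * ((polyRootCountMod ![g] k : ℝ) * (1 + Real.log k)) / k :=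
                div_le_div_of_nonneg_right h1 hk0.le
            _ = c₁ * ((polyRootCountMod ![g] k : ℝ) * (1 + Real.log k) / k) := by ring
      _ = c₁ * ∑ k ∈ (Icc 1 x).filter (fun k : ℕ => ∀ p ∈ k.primeFactors, p ^ 2 ∣ k),
            (polyRootCountMod ![g] k : ℝ) * (1 + Real.log k) / k := by rw [Finset.mul_sum]
      _ ≤ c₁ * W := mul_le_mul_of_nonneg_left (hW x) hc₁

/-- **Tail control**: `|(A_g − ∑_{k ≤ x} a_k) log x| ≤ c_{g,1} W` for `x ≥ 1`, because
`log x · ∑_{k > x} a_k ≤ ∑_{k > x} a_k log k`. [this work] -/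
theorem abs_tail_mul_log_le (g : ℤ[X]) {c₁ W : ℝ} (hc₁ : 0 ≤ c₁)
    (hc0 : ∀ m : ℕ, 0 < m → 0 ≤ rootDensityConst g m)
    (hc1 : ∀ m : ℕ, 0 < m → rootDensityConst g m ≤ c₁)
    (hW : ∀ Z : ℕ, ∑ k ∈ (Icc 1 Z).filter (fun k : ℕ => ∀ p ∈ k.primeFactors, p ^ 2 ∣ k),
        (polyRootCountMod ![g] k : ℝ) * (1 + Real.log k) / k ≤ W)
    (x : ℕ) :
    |(rootLevelConst g - ∑ k ∈ range (x + 1), rootLevelCoeff g k) * Real.log x| ≤ c₁ * W := by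
  have hsum : Summable (rootLevelCoeff g) :=
    summable_of_sum_range_le (rootLevelCoeff_nonneg g hc0) (sum_range_rootLevelCoeff_le g hc₁ hc1 hW)
  have hlim : Tendsto (fun Z => (∑ k ∈ range Z, rootLevelCoeff g k -
      ∑ k ∈ range (x + 1), rootLevelCoeff g k) * Real.log x) atTop
      (𝓝 ((rootLevelConst g - ∑ k ∈ range (x + 1), rootLevelCoeff g k) * Real.log x)) := by
    unfold rootLevelConst
    exact (hsum.tendsto_sum_tsum_nat.sub_const _).mul_const _
  have hlogx : 0 ≤ Real.log x := Real.log_natCast_nonneg x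
  -- the eventual bounds
  have hev : ∀ Z : ℕ, x + 1 ≤ Z →
      0 ≤ (∑ k ∈ range Z, rootLevelCoeff g k - ∑ k ∈ range (x + 1), rootLevelCoeff g k) *
          Real.log x ∧
      (∑ k ∈ range Z, rootLevelCoeff g k - ∑ k ∈ range (x + 1), rootLevelCoeff g k) *
          Real.log x ≤ c₁ * W := by
    intro Z hZ
    rw [← Finset.sum_Ico_eq_sub _ hZ]
    refine ⟨mul_nonneg (Finset.sum_nonneg fun k _ => rootLevelCoeff_nonneg g hc0 k) hlogx, ?_⟩
    obtain ⟨y, rfl⟩ : ∃ y, Z = y + 1 := ⟨Z - 1, by omega⟩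
    rw [Finset.sum_mul]
    calc ∑ k ∈ Ico (x + 1) (y + 1), rootLevelCoeff g k * Real.log x
        ≤ ∑ k ∈ Ico (x + 1) (y + 1),
            (if (∀ p ∈ k.primeFactors, p ^ 2 ∣ k) then
              c₁ * ((polyRootCountMod ![g] k : ℝ) * (1 + Real.log k) / k) else 0) := by
          refine Finset.sum_le_sum fun k hk => ?_
          have hxk : x + 1 ≤ k := (Finset.mem_Ico.1 hk).1
          have hk1 : 1 ≤ k := by omega
          have hk1' : (1 : ℝ) ≤ k := by exact_mod_cast hk1
          have hk0 : (0 : ℝ) < k := by linarith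
          have hxk' : (x : ℝ) ≤ k := by exact_mod_cast (by omega : x ≤ k)
          unfold rootLevelCoeff
          split_ifs with h
          · have hρ0 : 0 ≤ (polyRootCountMod ![g] k : ℝ) := Nat.cast_nonneg _
            have hlogk : Real.log x ≤ 1 + Real.log k := by
              rcases Nat.eq_zero_or_pos x with rfl | hx
              · simp only [Nat.cast_zero, Real.log_zero]
                have := Real.log_nonneg hk1'
                linarith
              · have hx0 : (0 : ℝ) < x := by exact_mod_cast hx
                have := Real.log_le_log hx0 hxk'
                linarith
            have hlog1 : 0 ≤ 1 + Real.log k := hlogx.trans hlogk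
            calc (polyRootCountMod ![g] k : ℝ) * rootDensityConst g k / k * Real.log x
                ≤ (polyRootCountMod ![g] k : ℝ) * c₁ / k * (1 + Real.log k) := by
                  refine mul_le_mul ?_ hlogk hlogx ?_
                  · exact div_le_div_of_nonneg_right
                      (mul_le_mul_of_nonneg_left (hc1 k hk1) hρ0) hk0.le
                  · exact div_nonneg (mul_nonneg hρ0 hc₁) hk0.le
              _ = c₁ * ((polyRootCountMod ![g] k : ℝ) * (1 + Real.log k) / k) := by ring
          · rw [zero_mul]
      _ ≤ ∑ k ∈ range (y + 1),
            (if (∀ p ∈ k.primeFactors, p ^ 2 ∣ k) then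
              c₁ * ((polyRootCountMod ![g] k : ℝ) * (1 + Real.log k) / k) else 0) := by
          refine Finset.sum_le_sum_of_subset_of_nonneg
            (fun k hk => Finset.mem_range.2 (Finset.mem_Ico.1 hk).2) fun k _ _ => ?_
          split_ifs
          · rcases Nat.eq_zero_or_pos k with rfl | hk
            · simp
            · have hk1' : (1 : ℝ) ≤ k := by exact_mod_cast hk
              have hlog1 : 0 ≤ 1 + Real.log k := by
                have := Real.log_nonneg hk1'
                linarith
              exact mul_nonneg hc₁ (div_nonneg (mul_nonneg (Nat.cast_nonneg _) hlog1)
                (Nat.cast_nonneg _))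
          · exact le_rfl
      _ = ∑ k ∈ (Icc 1 y).filter (fun k : ℕ => ∀ p ∈ k.primeFactors, p ^ 2 ∣ k),
            c₁ * ((polyRootCountMod ![g] k : ℝ) * (1 + Real.log k) / k) :=
          sum_range_succ_ite_eq_sum_filter _
            (fun k => c₁ * ((polyRootCountMod ![g] k : ℝ) * (1 + Real.log k) / k)) (by simp) y
      _ = c₁ * ∑ k ∈ (Icc 1 y).filter (fun k : ℕ => ∀ p ∈ k.primeFactors, p ^ 2 ∣ k),
            (polyRootCountMod ![g] k : ℝ) * (1 + Real.log k) / k := by rw [Finset.mul_sum]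
      _ ≤ c₁ * W := mul_le_mul_of_nonneg_left (hW y) hc₁
  have hge : 0 ≤ (rootLevelConst g - ∑ k ∈ range (x + 1), rootLevelCoeff g k) * Real.log x :=
    ge_of_tendsto hlim (Filter.eventually_atTop.2 ⟨x + 1, fun Z hZ => (hev Z hZ).1⟩)
  have hle : (rootLevelConst g - ∑ k ∈ range (x + 1), rootLevelCoeff g k) * Real.log x ≤
      c₁ * W :=
    le_of_tendsto hlim (Filter.eventually_atTop.2 ⟨x + 1, fun Z hZ => (hev Z hZ).2⟩)
  rw [abs_of_nonneg hge]
  exact hle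

/-! ### The termwise error of the decomposition -/

/-- For a squarefull `k ∈ [1, x]`:
`|(ρ_g(k)/k) G_k(⌊x/k⌋) − (a_k log x − ρ_g(k) c_{g,k} log k/k)| ≤ (ρ_g(k)(1+log k)/k)(K + c_{g,1} log 2)`.
[this work] -/
theorem abs_sqfull_term_sub_le (g : ℤ[X]) {K c₁ : ℝ} (hc₁ : 0 ≤ c₁)
    (hc0 : ∀ m : ℕ, 0 < m → 0 ≤ rootDensityConst g m)
    (hc1 : ∀ m : ℕ, 0 < m → rootDensityConst g m ≤ c₁)
    (hG : ∀ m : ℕ, 0 < m → ∀ y : ℕ, 1 ≤ y →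
      |polySqfreeLevel g m y - rootDensityConst g m * Real.log y| ≤ K * (1 + Real.log m))
    {x k : ℕ} (hk : 1 ≤ k) (hkx : k ≤ x) :
    |(polyRootCountMod ![g] k : ℝ) / k * polySqfreeLevel g k (x / k) -
        ((polyRootCountMod ![g] k : ℝ) * rootDensityConst g k / k * Real.log x -
          (polyRootCountMod ![g] k : ℝ) * rootDensityConst g k * Real.log k / k)| ≤
      (polyRootCountMod ![g] k : ℝ) * (1 + Real.log k) / k * (K + c₁ * Real.log 2) := by
  set ρk : ℝ := (polyRootCountMod ![g] k : ℝ) with hρk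
  set ck : ℝ := rootDensityConst g k with hck
  set G : ℝ := polySqfreeLevel g k (x / k) with hGdef
  set Ly : ℝ := Real.log ((x / k : ℕ) : ℝ) with hLy
  have hy1 : 1 ≤ x / k := (Nat.le_div_iff_mul_le hk).2 (by simpa using hkx)
  have e1 : |G - ck * Ly| ≤ K * (1 + Real.log k) := hG k hk (x / k) hy1
  have e2 : |Ly - (Real.log x - Real.log k)| ≤ Real.log 2 := abs_log_nat_div_sub_le hk hkx
  have hk0 : (0 : ℝ) < k := by exact_mod_cast hk
  have hρ0 : 0 ≤ ρk := Nat.cast_nonneg _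
  have hck0 : 0 ≤ ck := hc0 k hk
  have hck1 : ck ≤ c₁ := hc1 k hk
  have hlogk : 0 ≤ Real.log k := Real.log_natCast_nonneg k
  have hlog2 : 0 ≤ Real.log 2 := Real.log_nonneg (by norm_num)
  have hK : 0 ≤ K * (1 + Real.log k) := (abs_nonneg _).trans e1
  have hdiff : ρk / k * G - (ρk * ck / k * Real.log x - ρk * ck * Real.log k / k) =
      ρk / k * ((G - ck * Ly) + ck * (Ly - (Real.log x - Real.log k))) := by ring
  rw [hdiff, abs_mul, abs_of_nonneg (div_nonneg hρ0 hk0.le)]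
  have h3 : |(G - ck * Ly) + ck * (Ly - (Real.log x - Real.log k))| ≤
      K * (1 + Real.log k) + c₁ * Real.log 2 := by
    calc |(G - ck * Ly) + ck * (Ly - (Real.log x - Real.log k))|
        ≤ |G - ck * Ly| + |ck * (Ly - (Real.log x - Real.log k))| := abs_add_le _ _
      _ ≤ K * (1 + Real.log k) + c₁ * Real.log 2 := by
          rw [abs_mul, abs_of_nonneg hck0]
          exact add_le_add e1 (mul_le_mul hck1 e2 (abs_nonneg _) hc₁)
  have h4 : K * (1 + Real.log k) + c₁ * Real.log 2 ≤ (1 + Real.log k) * (K + c₁ * Real.log 2) := by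
    nlinarith [mul_nonneg (mul_nonneg hc₁ hlog2) hlogk]
  calc ρk / k * |(G - ck * Ly) + ck * (Ly - (Real.log x - Real.log k))|
      ≤ ρk / k * ((1 + Real.log k) * (K + c₁ * Real.log 2)) :=
        mul_le_mul_of_nonneg_left (h3.trans h4) (div_nonneg hρ0 hk0.le)
    _ = ρk * (1 + Real.log k) / k * (K + c₁ * Real.log 2) := by ring

/-! ### The mean value -/

/-- **Dedekind–Landau mean value, elementary kernel version.**  For `g ∈ ℤ[X]` irreducible of
positive degree there is `K` with `|∑_{d ≤ x} ρ_g(d)/d − A_g log x| ≤ K` for all `x ≥ 1`, where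
`A_g = rootLevelConst g`. [this work] -/
theorem exists_abs_polySmallLevel_sub_log_le {g : ℤ[X]} (hirr : Irreducible g)
    (hdeg : 0 < g.natDegree) :
    ∃ K : ℝ, ∀ x : ℕ, 1 ≤ x → |polySmallLevel g x - rootLevelConst g * Real.log x| ≤ K := by
  obtain ⟨K, hK⟩ := exists_abs_polySqfreeLevel_sub_le hirr hdeg
  obtain ⟨W, hW0, hW⟩ := exists_sum_sqfull_rootCount_weight_le hirr hdeg
  set c₁ : ℝ := rootDensityConst g 1 with hc₁def
  have hc0 : ∀ m : ℕ, 0 < m → 0 ≤ rootDensityConst g m := fun m hm => (hK m hm).2.1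
  have hc1 : ∀ m : ℕ, 0 < m → rootDensityConst g m ≤ c₁ := fun m hm => (hK m hm).2.2.1
  have hc₁0 : 0 ≤ c₁ := hc0 1 one_pos
  set K' : ℝ := max K 0 with hK'def
  have hK'0 : 0 ≤ K' := le_max_right _ _
  have hG : ∀ m : ℕ, 0 < m → ∀ y : ℕ, 1 ≤ y →
      |polySqfreeLevel g m y - rootDensityConst g m * Real.log y| ≤ K' * (1 + Real.log m) := by
    intro m hm y hy
    refine ((hK m hm).2.2.2 y hy).trans ?_
    have : 0 ≤ 1 + Real.log m := by
      have := Real.log_natCast_nonneg m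
      linarith
    exact mul_le_mul_of_nonneg_right (le_max_left _ _) this
  refine ⟨W * (K' + c₁ * Real.log 2) + c₁ * W + c₁ * W, fun x hx => ?_⟩
  set t : Finset ℕ := (Icc 1 x).filter (fun k : ℕ => ∀ p ∈ k.primeFactors, p ^ 2 ∣ k) with ht
  set S : ℝ := ∑ k ∈ t, (polyRootCountMod ![g] k : ℝ) * rootDensityConst g k / k with hS
  set N : ℝ := ∑ k ∈ t, (polyRootCountMod ![g] k : ℝ) * rootDensityConst g k * Real.log k / k
    with hN
  have hmem : ∀ k ∈ t, 1 ≤ k ∧ k ≤ x := fun k hk =>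
    Finset.mem_Icc.1 (Finset.mem_filter.1 hk).1
  -- (1) the decomposition with termwise errors
  have h1 : |polySmallLevel g x - (S * Real.log x - N)| ≤ W * (K' + c₁ * Real.log 2) := by
    rw [polySmallLevel_eq_sum_sqfull g x]
    have hSN : S * Real.log x - N = ∑ k ∈ t,
        ((polyRootCountMod ![g] k : ℝ) * rootDensityConst g k / k * Real.log x -
          (polyRootCountMod ![g] k : ℝ) * rootDensityConst g k * Real.log k / k) := by
      rw [Finset.sum_sub_distrib, Finset.sum_mul]
    rw [hSN, ← Finset.sum_sub_distrib]
    calc |∑ k ∈ t, ((polyRootCountMod ![g] k : ℝ) / k * polySqfreeLevel g k (x / k) -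
            ((polyRootCountMod ![g] k : ℝ) * rootDensityConst g k / k * Real.log x -
              (polyRootCountMod ![g] k : ℝ) * rootDensityConst g k * Real.log k / k))|
        ≤ ∑ k ∈ t, |(polyRootCountMod ![g] k : ℝ) / k * polySqfreeLevel g k (x / k) -
            ((polyRootCountMod ![g] k : ℝ) * rootDensityConst g k / k * Real.log x -
              (polyRootCountMod ![g] k : ℝ) * rootDensityConst g k * Real.log k / k)| :=
          Finset.abs_sum_le_sum_abs _ _
      _ ≤ ∑ k ∈ t, (polyRootCountMod ![g] k : ℝ) * (1 + Real.log k) / k * (K' + c₁ * Real.log 2) :=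
          Finset.sum_le_sum fun k hk =>
            abs_sqfull_term_sub_le g hc₁0 hc0 hc1 hG (hmem k hk).1 (hmem k hk).2
      _ = (∑ k ∈ t, (polyRootCountMod ![g] k : ℝ) * (1 + Real.log k) / k) *
            (K' + c₁ * Real.log 2) := by rw [Finset.sum_mul]
      _ ≤ W * (K' + c₁ * Real.log 2) := mul_le_mul_of_nonneg_right (hW x) (by positivity)
  -- (2) `0 ≤ N ≤ c₁ W`
  have h2 : 0 ≤ N ∧ N ≤ c₁ * W := by
    constructor
    · refine Finset.sum_nonneg fun k hk => ?_
      have hk1 := (hmem k hk).1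
      exact div_nonneg (mul_nonneg (mul_nonneg (Nat.cast_nonneg _) (hc0 k hk1))
        (Real.log_natCast_nonneg k)) (Nat.cast_nonneg _)
    · calc N ≤ ∑ k ∈ t, c₁ * ((polyRootCountMod ![g] k : ℝ) * (1 + Real.log k) / k) := by
            refine Finset.sum_le_sum fun k hk => ?_
            have hk1 := (hmem k hk).1
            have hk1' : (1 : ℝ) ≤ k := by exact_mod_cast hk1
            have hk0 : (0 : ℝ) < k := by linarith
            have hρ0 : 0 ≤ (polyRootCountMod ![g] k : ℝ) := Nat.cast_nonneg _
            have hlogk : 0 ≤ Real.log k := Real.log_natCast_nonneg k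
            have hnum : (polyRootCountMod ![g] k : ℝ) * rootDensityConst g k * Real.log k ≤
                c₁ * ((polyRootCountMod ![g] k : ℝ) * (1 + Real.log k)) := by
              have h1 : (polyRootCountMod ![g] k : ℝ) * rootDensityConst g k * Real.log k ≤
                  (polyRootCountMod ![g] k : ℝ) * c₁ * Real.log k :=
                mul_le_mul_of_nonneg_right (mul_le_mul_of_nonneg_left (hc1 k hk1) hρ0) hlogk
              nlinarith [mul_nonneg hc₁0 hρ0]
            calc (polyRootCountMod ![g] k : ℝ) * rootDensityConst g k * Real.log k / k
                ≤ c₁ * ((polyRootCountMod ![g] k : ℝ) * (1 + Real.log k)) / k :=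
                  div_le_div_of_nonneg_right hnum hk0.le
              _ = c₁ * ((polyRootCountMod ![g] k : ℝ) * (1 + Real.log k) / k) := by ring
        _ = c₁ * ∑ k ∈ t, (polyRootCountMod ![g] k : ℝ) * (1 + Real.log k) / k := by
            rw [Finset.mul_sum]
        _ ≤ c₁ * W := mul_le_mul_of_nonneg_left (hW x) hc₁0
  -- (3) the tail
  have h3 : |(rootLevelConst g - S) * Real.log x| ≤ c₁ * W := by
    have h := abs_tail_mul_log_le g hc₁0 hc0 hc1 hW x
    rwa [sum_range_rootLevelCoeff] at h
  have hsplit : polySmallLevel g x - rootLevelConst g * Real.log x =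
      (polySmallLevel g x - (S * Real.log x - N)) - (rootLevelConst g - S) * Real.log x - N := by
    ring
  rw [hsplit]
  calc |polySmallLevel g x - (S * Real.log x - N) - (rootLevelConst g - S) * Real.log x - N|
      ≤ |polySmallLevel g x - (S * Real.log x - N) - (rootLevelConst g - S) * Real.log x| + |N| :=
        abs_sub _ _
    _ ≤ |polySmallLevel g x - (S * Real.log x - N)| + |(rootLevelConst g - S) * Real.log x| +
          |N| := by
        gcongr
        exact abs_sub _ _
    _ ≤ W * (K' + c₁ * Real.log 2) + c₁ * W + c₁ * W := by
        rw [abs_of_nonneg h2.1]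
        linarith [h1, h3, h2.2]

/-- The same in the `∃ A K, ∀ x ≥ 2` shape of hypothesis `hL` of
`exists_abs_polyDivisorSum_sub_located_sub_log_le`. [this work] -/
theorem exists_abs_polySmallLevel_sub_log_le_two {g : ℤ[X]} (hirr : Irreducible g)
    (hdeg : 0 < g.natDegree) :
    ∃ A K : ℝ, ∀ x : ℕ, 2 ≤ x → |polySmallLevel g x - A * Real.log x| ≤ K := by
  obtain ⟨K, hK⟩ := exists_abs_polySmallLevel_sub_log_le hirr hdeg
  exact ⟨rootLevelConst g, K, fun x hx => hK x (by omega)⟩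

/-! ### Consequences: Statement 5 of the divisor-pairing storey, unconditionally -/

/-- **`∑_{n ≤ x} τ(g(n)) = 2 A_g x log x + 2 N_g(x) + O_g(x)`, unconditionally.**  For
`g ∈ ℤ[X]` irreducible of positive degree with `n² ≤ |g(n)|` for `n ≥ 1`:
`|∑_{n ≤ x} τ(g(n)) − 2 N_g(x) − 2 A_g x log x| ≤ C x` for `x ≥ 2`, where
`N_g(x) = polyLocatedRootCount g x`. [this work] -/
theorem exists_abs_polyDivisorSum_sub_located_sub_log_le_uncond {g : ℤ[X]}
    (hirr : Irreducible g) (hdeg : 0 < g.natDegree)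
    (hsq : ∀ n : ℕ, 1 ≤ n → n * n ≤ (g.eval (n : ℤ)).natAbs) :
    ∃ C : ℝ, ∀ x : ℕ, 2 ≤ x →
      |(polyDivisorSum g x : ℝ) - 2 * (polyLocatedRootCount g x : ℝ) -
          2 * rootLevelConst g * (x : ℝ) * Real.log x| ≤ C * x := by
  obtain ⟨K, hK⟩ := exists_abs_polySmallLevel_sub_log_le hirr hdeg
  exact exists_abs_polyDivisorSum_sub_located_sub_log_le hirr hdeg hsq
    (A := rootLevelConst g) (K := K) fun x hx => hK x (by omega)

/-- **The cubic `X³ + 2`**: `|∑_{n ≤ x} τ(n³+2) − 2 N(x) − 2 A x log x| ≤ B x` for `x ≥ 2`, with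
`A = rootLevelConst (X³+2)` and `N(x)` the located-root count — the entire asymptotic problem for
`∑ τ(n³+2)` sits in `N(x)`. [this work] -/
theorem exists_abs_polyDivisorSum_cubic_sub_log_le :
    ∃ B : ℝ, ∀ x : ℕ, 2 ≤ x →
      |(polyDivisorSum (X ^ 3 + C 2) x : ℝ) - 2 * (polyLocatedRootCount (X ^ 3 + C 2) x : ℝ) -
          2 * rootLevelConst (X ^ 3 + C 2 : ℤ[X]) * (x : ℝ) * Real.log x| ≤ B * x :=
  exists_abs_polyDivisorSum_sub_located_sub_log_le_uncond
    Literature.NumberTheory.Sieve.LargestPrimeFactorCubic.irreducible_X_pow_three_add_two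
    (by rw [natDegree_X_pow_add_C]; norm_num) sq_le_natAbs_eval_cubic

end Summit.Parity.BatemanHorn.Theorems
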